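import Summits.ABC.StewartYu.PadicG3Schedule
import Summits.ABC.StewartYu.PadicG3FrameData
import Summits.ABC.StewartYu.PadicG3FrameOdd
import Summits.ABC.StewartYu.PadicG3StartR
import HarnessLib

/-!
# Cell abc-stewartyu, crux `Y07Odd` (stmt-ABC-19658), line `gen3-slab-odd`: the frame from the record's supply with the RESTRICTED Siegel count
# (`RecordSupplyAtR` / `RecordSupplyOddR` / `frameOdd_of_recordR` — verbatim twins of the `'` versions of `PadicG3FrameOdd` with the level-0
# equation set `Icc(−X₀,X₀) ×ˢ tauSetR n j₀ T₀` in place of `… ×ˢ tauSet n T₀`, via `PadicG3StartR.start_restricted`)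

`Summits/ABC/StewartYu/PadicG3FrameOddR.lean` — cell `abc-stewartyu` (seat p2-g4, F-odd lead).  No named fact.  The count charged to the record is
now Nesterenko's `2·(2X₀+1)·#tauSetR·(p−1)p^m ≍ X₀·T₀ⁿ/n!` (the `j₀`-direction equations are free), which (B1) of the record affords.

References: Yu. V. Nesterenko, LNM 1819 (2003) Prop 4.1, (4.6), §5.
-/


noncomputable section

open NormedSpace Finset Polynomial
open Literature.NumberTheory.Transcendental
open Literature.NumberTheory.Transcendental.CW77.Setup (Tau tauNorm)
open Summit.ABC.StewartYu.GenThreeFrameSpecOdd (FrameOdd RecordOdd)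
open scoped Nat

namespace Summit.ABC.StewartYu

namespace G3Setup

variable {p : ℕ} [Fact p.Prime]

/-- **The record's supply for one datum, relaxed form**: as `RecordSupplyAt`, but the record chooses the output degree bound `D₀ ≥ L₀` and box
`D ≥ 2·Lb s Ŝ` for which it proves `RecordOdd` (its closed forms, e.g. `D₀ = L₀ + 1`, `D j = ⌊…⌋ + 1`). [cite: Nesterenko2003, §5; shape only] -/
def RecordSupplyAtR (S : G3Setup p) (C : ℕ → ℝ) (V : Fin S.n → ℝ) (Vmax W : ℝ) : Prop :=
  ∃ (m : ℕ) (s : Fin S.n → ℕ) (L₀ H Sh X₀ T₀ : ℕ) (N T : ℕ → ℕ → ℕ) (Nh : ℕ → ℕ) (X' S₀ : ℕ)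
    (den₀ : ℤ × Tau S.n → ℕ) (M₀ : ℤ × Tau S.n → ℤ) (Xb : ℤ) (Amax : ℝ) (D₀ : ℕ) (D : Fin S.n → ℕ),
    1 ≤ T₀ ∧ N 0 0 = X₀ ∧ T 0 0 = T₀ ∧
    ‖S.Λ / (S.b S.j₀ : ℚ_[p])‖ ≤ (p : ℝ)⁻¹ ∧ ‖S.Λ / (S.b S.j₀ : ℚ_[p])‖ ≤ (p : ℝ)⁻¹ ^ (m + 1) ∧
    2 * (Icc (-(X₀ : ℤ)) X₀ ×ˢ tauSetR S.n S.j₀ T₀).card * ((p - 1) * p ^ m) ≤ (L₀ + 1) * ∏ j, (2 * s j + 1) ∧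
    (∀ e ∈ Icc (-(X₀ : ℤ)) X₀ ×ˢ tauSetR S.n S.j₀ T₀, 1 ≤ den₀ e) ∧
    (∀ e ∈ Icc (-(X₀ : ℤ)) X₀ ×ˢ tauSetR S.n S.j₀ T₀, ∀ ℓ₀ ≤ L₀,
      ∃ z₀ : ℤ, (den₀ e : ℚ) * (hasseDeriv e.2.1 (S.Rl H Sh 0 (ℓ₀, 0))).eval (e.1 : ℚ) = z₀ ∧ |z₀| ≤ M₀ e) ∧
    (∀ lam ∈ S.box s, ∀ lam' ∈ S.box s, ∀ k, |S.𝔛 (lam - lam') k| ≤ Xb) ∧ 1 ≤ Amax ∧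
    (∀ e ∈ Icc (-(X₀ : ℤ)) X₀ ×ˢ tauSetR S.n S.j₀ T₀, (M₀ e : ℝ) * (Xb : ℝ) ^ (∑ k, e.2.2 k) *
      ((MonomialDen.monDen S.α (S.boxExpG (fun j => 2 * s j) e.1) : ℝ)) ^ 2 ≤ Amax) ∧
    (∀ 𝔏 ⊆ S.box s,
      (∀ ν < S.n, S.KStepHypU (S.Rl H Sh 0) (S.unk L₀ 𝔏) (S.Lb s 0) ⌈((S.unk L₀ 𝔏).card : ℝ) * Amax⌉ m
        (N 0 ν) (N 0 (ν + 1)) (T 0 ν) (T 0 (ν + 1))) ∧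
      (∀ lev < Sh, S.HalfStepHypU (S.Rl H Sh lev) (S.Rl H Sh (lev + 1)) (S.unk L₀ 𝔏) (S.Lb s lev)
        ⌈((S.unk L₀ 𝔏).card : ℝ) * Amax⌉ m (N lev S.n) (Nh (lev + 1)) (T lev S.n) (T (lev + 1) 0)) ∧
      (∀ lev < Sh, S.KStepOddHypU (S.Rl H Sh (lev + 1)) (S.unk L₀ 𝔏) (S.Lb s (lev + 1)) ⌈((S.unk L₀ 𝔏).card : ℝ) * Amax⌉ m
        (Nh (lev + 1)) (N (lev + 1) 1) (T (lev + 1) 0) (T (lev + 1) 1)) ∧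
      (∀ lev < Sh, ∀ ν, 1 ≤ ν → ν < S.n → S.KStepHypU (S.Rl H Sh (lev + 1)) (S.unk L₀ 𝔏) (S.Lb s (lev + 1))
        ⌈((S.unk L₀ 𝔏).card : ℝ) * Amax⌉ m (N (lev + 1) ν) (N (lev + 1) (ν + 1)) (T (lev + 1) ν) (T (lev + 1) (ν + 1)))) ∧
    2 * ((S.n + 1) * X') ≤ N Sh S.n ∧ (S.n + 1) * S₀ < T Sh S.n ∧
    L₀ ≤ D₀ ∧ (∀ j, 2 * S.Lb s Sh j ≤ D j) ∧ RecordOdd C p S.n V Vmax W D₀ S₀ X' D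

/-- **The record's supply at rank `n`, prime `p`, relaxed form.** [cite: Nesterenko2003, §5; shape only] -/
def RecordSupplyOddR (C : ℕ → ℝ) (p n : ℕ) [Fact p.Prime] : Prop :=
  ∀ (S : G3Setup p) (V : Fin S.n → ℝ) (Vmax W : ℝ), S.n = n →
    (∀ j, padicValRat p (S.α j) = 0) →
    (∀ κ : Fin S.n → ℤ, (∃ γ : ℚ, ∏ j, S.α j ^ κ j = γ ^ 2 ∨ ∏ j, S.α j ^ κ j = -γ ^ 2) → ∀ j, (2 : ℤ) ∣ κ j) →
    (∀ j, Height.logHeight₁ (S.α j) ≤ V j) → (∀ j, 1 ≤ V j) → (∀ j, V j ≤ Vmax) →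
    (∀ j, Real.log (max 3 (|S.b j| : ℝ)) ≤ W) → 1 ≤ W →
    ¬ (padicValRat p (∏ j, S.α j ^ S.b j - 1) : ℝ) * Real.log p ≤
        C S.n * ((p : ℝ) / Real.log p) * (∏ j, V j) * (W + Real.log p + Real.log (2 * Vmax)) →
    S.RecordSupplyAtR C V Vmax W

/-- **THE ODD-`p` FRAME FROM THE RECORD'S SUPPLY (relaxed form).** [cite: Nesterenko2003, Prop 4.1, §5] -/
theorem frameOdd_of_recordR {C : ℕ → ℝ} {n : ℕ} (hn : 1 ≤ n) (hp2 : p ≠ 2) (hrec : RecordSupplyOddR C p n) : FrameOdd C p n := by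
  classical
  intro α b V Vmax W hα hind hK hV hV1 hVmax hb hW hW1 hneg
  obtain ⟨j₀, hbj₀, hbmin⟩ := G3FrameData.exists_pivot (p := p) b hb
  have hp3 : 3 ≤ p := G3FrameData.three_le_of_prime_ne_two hp2
  set S : G3Setup p := G3Setup.ofData hp3 α (fun j => (hα j).1) (fun j => (hα j).2) b j₀ hbj₀ hbmin with hSdef
  have hSn : S.n = n := rfl
  refine ⟨j₀, ?_⟩
  obtain ⟨m, s, L₀, H, Sh, X₀, T₀, N, T, Nh, X', S₀, den₀, M₀, Xb, Amax, D₀, D, hT₀, hN00, hT00, hΛ, hΛm, hcount, hden₀, hR, hXb, hAmax, hA,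
    hpacks, hXfin, hSfin, hD₀, hD, hrecord⟩ := hrec S V Vmax W rfl (fun j => (hα j).2) hK hV hV1 hVmax hW hW1 hneg
  obtain ⟨ζ, r, hζ, hζM, hζ1, hη⟩ := G3Setup.ofData_exists_zeta hp3 α (fun j => (hα j).1) (fun j => (hα j).2) b j₀ hbj₀ hbmin
  have hindS : ∀ T₁ : Finset (Fin S.n), T₁.Nonempty → ¬ IsSquare (∏ j ∈ T₁, S.α j) ∧ ¬ IsSquare (-∏ j ∈ T₁, S.α j) :=
    fun T₁ hT₁ => G3FrameData.not_isSquare_prod_of_kummer S.α hK T₁ hT₁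
  obtain ⟨𝔏, lamb, pv, h𝔏, hlamb, hstart⟩ := S.start_restricted m s L₀ (fun ℓ₀ => S.Rl H Sh 0 (ℓ₀, 0)) X₀ T₀ hT₀ hΛm
    (Icc (-(X₀ : ℤ)) X₀ ×ˢ tauSetR S.n S.j₀ T₀) rfl hcount den₀ hden₀ M₀ hR hXb hAmax hA
  obtain ⟨hK0, hH, hO, hKs⟩ := hpacks 𝔏 h𝔏
  have hRl0 : (fun i : ℕ × (Fin S.n → ℤ) => S.Rl H Sh 0 (i.1, 0)) = S.Rl H Sh 0 := by
    funext i; unfold Rl; rfl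
  rw [hRl0] at hstart
  have hstart' : S.LvInvI (S.Rl H Sh 0) (S.unk L₀ 𝔏) (fun i => i.2 - lamb) (fun _ => 1) pv (fun j => -(s j : ℤ) - lamb j) (S.Lb s 0)
      ⌈((S.unk L₀ 𝔏).card : ℝ) * Amax⌉ m {x : ℤ | |x| ≤ (N 0 0 : ℤ)} (T 0 0) := by
    rw [hN00, hT00]; exact hstart
  have hlev0 := kchain (subset_refl _) hΛ (N 0) (T 0) 0 S.n (fun ν _ h1 => hK0 ν (by omega)) hstart'
  rw [zero_add] at hlev0
  have hst0 : S.LevelState H Sh s (S.unk L₀ 𝔏) pv ⌈((S.unk L₀ 𝔏).card : ℝ) * Amax⌉ m 0 (N 0 S.n) (T 0 S.n) := by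
    refine ⟨S.unk L₀ 𝔏, fun i => i.2 - lamb, fun _ => 1, _, subset_refl _, ?_, hlev0⟩
    intro i _ i' _
    constructor
    · intro h
      funext j
      have hj := congrFun h j
      simp only [Pi.sub_apply] at hj
      omega
    · intro h
      simp only [h]
  have hn1 : 1 ≤ S.n := hSn ▸ hn
  have hfinal := levels hn1 hΛ hΛm hζ hζM hζ1 r hη hindS N T Nh hH hO hKs hst0 Sh le_rfl
  have hout := frameOutput_of_levelState hfinal hXfin hSfin
  exact ⟨D₀, S₀, X', D, hbj₀, frameOutputTwo_mono hD₀ hD hout, hrecord⟩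

end G3Setup

end Summit.ABC.StewartYu

end
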